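import Mathlib
import Summits.Schanuel.Schanuel.Statement
import Summits.Schanuel.Schanuel.Theses.GeodesicRealLogs
import Literature.Barriers.Schanuel.AlgebraicIndependenceOfLogarithms
import HarnessLib

/-!
# Crux `RealLogSector` (stmt-Schanuel-11767) — strength calibration (cstrat r1 evidence; NOT a proof of the crux)

Seat `planner-cstrat-stmt-Schanuel-11767-r1-0` (crux-strategist, redirect r1), route `GeodesicRealLogs`.
Everything below is sorry-free bookkeeping placing the crux

  `RealLogSector = ∀ n (l : Fin n → ℝ), (∀ i, IsAlgebraic ℚ (Real.exp (l i))) → LinearIndependent ℚ l →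
     AlgebraicIndependent ℚ l`

between known open statements; it closes nothing.

1. `realLogSector_of_algIndepLogarithms` : the catalogued OPEN conjecture
   `Literature.Barriers.Schanuel.AlgIndepLogarithms` (= route LogPatterns / MatrixCoefficients /
   ExpMordellWeil's shared crux `LogSector`, stmt-Schanuel-4310, by `Iff.rfl`) implies the crux: transport
   along `ℝ → ℂ`. So the crux is DOMINATED BY AN EXISTING SHARED CRUX that is itself strictly below the
   summit as far as anyone knows.
2. `realLogSector_of_schanuel` : the summit implies the crux (the crux is a CONSEQUENCE of S; `S → C`).
3. `realLogSector_of_homLogSector_of_logHomogeneity` : the only honest typed decomposition found — it is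
   route MatrixCoefficients' GRADING SPLIT of `LogSector` (Cruxes/LogSector/Split.lean, seat cstrat-4310-r1:
   HomLogSector ∧ LogHomogeneity → LogSector), composed with (1). Its pieces are LogSector's pieces; nothing
   real-specific enters.
4. `realLogSector_of_realHom_of_realHomogeneity` + `realHomLogSector_of_homLogSector`,
   `realLogHomogeneity_of_logHomogeneity` : the same seam cut inside the real sector, and the fact that each
   real piece is again just the restriction of the corresponding complex piece.

The converse directions `RealLogSector → AlgIndepLogarithms`, `RealLogSector → Schanuel` are unknown
(cheap probes fail: bc/RealLogSector_probe*.lean); no claim is made about them.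
-/

noncomputable section

set_option linter.dupNamespace false

namespace Summit.Schanuel.Schanuel.Cruxes.RealLogSector.Calibration

open Summit.Schanuel.Schanuel.Theses.GeodesicRealLogs (RealLogSector)
open Literature.Barriers.Schanuel (AlgIndepLogarithms algIndepLogarithms_of_schanuel)

/-- The `ℚ`-algebra embedding `ℝ → ℂ`. -/
def ofRealQ : ℝ →ₐ[ℚ] ℂ := Complex.ofRealAm.restrictScalars ℚ

@[simp] theorem ofRealQ_apply (x : ℝ) : ofRealQ x = (x : ℂ) := rfl

theorem ofRealQ_injective : Function.Injective ofRealQ := fun x y h => by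
  simpa using h

/-- Transport of the hypotheses: real logarithms of algebraic numbers are complex logarithms of algebraic
numbers. -/
theorem isAlgebraic_cexp_ofReal {x : ℝ} (h : IsAlgebraic ℚ (Real.exp x)) :
    IsAlgebraic ℚ (Complex.exp (x : ℂ)) := by
  have := h.algHom ofRealQ
  simpa [Complex.ofReal_exp] using this

theorem linearIndependent_ofReal_comp {n : ℕ} {l : Fin n → ℝ} (h : LinearIndependent ℚ l) :
    LinearIndependent ℚ (fun i => (l i : ℂ)) := by
  have := h.map' (ofRealQ.toLinearMap) (LinearMap.ker_eq_bot.mpr ofRealQ_injective)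
  simpa [Function.comp_def] using this

/-- **(1) The crux is dominated by the shared crux `LogSector` = `AlgIndepLogarithms`.** -/
theorem realLogSector_of_algIndepLogarithms (h : AlgIndepLogarithms) : RealLogSector := by
  intro n l halg hli
  have hc : AlgebraicIndependent ℚ (fun i => (l i : ℂ)) :=
    h n _ (fun i => isAlgebraic_cexp_ofReal (halg i)) (linearIndependent_ofReal_comp hli)
  have : AlgebraicIndependent ℚ (ofRealQ ∘ l) := by
    simpa [Function.comp_def] using hc
  exact AlgebraicIndependent.of_comp ofRealQ this

/-- **(2) The summit implies the crux** (`S → C`; the route's support item `RealLogSectorOfSchanuel`,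
stmt-Schanuel-11775, is this statement). -/
theorem realLogSector_of_schanuel (hS : _root_.Schanuel) : RealLogSector :=
  realLogSector_of_algIndepLogarithms (algIndepLogarithms_of_schanuel hS)

/-! ## (3) The grading split of `LogSector`, transported -/

/-- LEAF 1 of the LogSector grading split (verbatim the children.json of Cruxes/LogSector/STRATEGY-CENSUS.md):
the HOMOGENEOUS conjecture of algebraic independence of logarithms. -/
def HomLogSector : Prop :=
  ∀ (n : ℕ) (l : Fin n → ℂ), (∀ i, IsAlgebraic ℚ (Complex.exp (l i))) → LinearIndependent ℚ l →
    ∀ (d : ℕ) (P : MvPolynomial (Fin n) ℚ), P.IsHomogeneous d → P ≠ 0 → MvPolynomial.aeval l P ≠ 0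

/-- LEAF 2 of the LogSector grading split (verbatim): Baker's inhomogeneity principle in all degrees. -/
def LogHomogeneity : Prop :=
  ∀ (r : ℕ) (l : Fin r → ℂ), (∀ j, IsAlgebraic ℚ (Complex.exp (l j))) →
    ∀ P : MvPolynomial (Fin r) ℚ, MvPolynomial.aeval l P = 0 →
      ∀ d : ℕ, MvPolynomial.aeval l (MvPolynomial.homogeneousComponent d P) = 0

/-- The grading glue for the complex conjecture (same five lines as
`Cruxes/LogSector/Split.lean: logSector_of_homLogSector_of_logHomogeneity`). -/
theorem algIndepLogarithms_of_hom_of_homogeneity (h₁ : HomLogSector) (h₂ : LogHomogeneity) :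
    AlgIndepLogarithms := by
  intro n l halg hli
  rw [algebraicIndependent_iff]
  intro P hP
  rw [← MvPolynomial.sum_homogeneousComponent P]
  refine Finset.sum_eq_zero fun d _ => ?_
  by_contra hne
  exact h₁ n l halg hli d _ (MvPolynomial.homogeneousComponent_isHomogeneous d P) hne (h₂ n l halg P hP d)

/-- **(3) The only honest typed decomposition of the crux found by this seat is LogSector's grading split.** -/
theorem realLogSector_of_homLogSector_of_logHomogeneity (h₁ : HomLogSector) (h₂ : LogHomogeneity) :
    RealLogSector :=
  realLogSector_of_algIndepLogarithms (algIndepLogarithms_of_hom_of_homogeneity h₁ h₂)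

/-! ## (4) The same seam inside the real sector, and its domination by the complex pieces -/

/-- Real LEAF 1: no nonzero homogeneous rational polynomial vanishes at `ℚ`-independent REAL logarithms of
algebraic numbers. -/
def RealHomLogSector : Prop :=
  ∀ (n : ℕ) (l : Fin n → ℝ), (∀ i, IsAlgebraic ℚ (Real.exp (l i))) → LinearIndependent ℚ l →
    ∀ (d : ℕ) (P : MvPolynomial (Fin n) ℚ), P.IsHomogeneous d → P ≠ 0 → MvPolynomial.aeval l P ≠ 0

/-- Real LEAF 2: relations among real logarithms of algebraic numbers hold degree by degree. -/
def RealLogHomogeneity : Prop :=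
  ∀ (r : ℕ) (l : Fin r → ℝ), (∀ j, IsAlgebraic ℚ (Real.exp (l j))) →
    ∀ P : MvPolynomial (Fin r) ℚ, MvPolynomial.aeval l P = 0 →
      ∀ d : ℕ, MvPolynomial.aeval l (MvPolynomial.homogeneousComponent d P) = 0

theorem realLogSector_of_realHom_of_realHomogeneity (h₁ : RealHomLogSector) (h₂ : RealLogHomogeneity) :
    RealLogSector := by
  intro n l halg hli
  rw [algebraicIndependent_iff]
  intro P hP
  rw [← MvPolynomial.sum_homogeneousComponent P]
  refine Finset.sum_eq_zero fun d _ => ?_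
  by_contra hne
  exact h₁ n l halg hli d _ (MvPolynomial.homogeneousComponent_isHomogeneous d P) hne (h₂ n l halg P hP d)

/-- Evaluation commutes with the embedding `ℝ → ℂ`. -/
theorem aeval_ofReal_comp {n : ℕ} (l : Fin n → ℝ) (P : MvPolynomial (Fin n) ℚ) :
    MvPolynomial.aeval (fun i => (l i : ℂ)) P = ((MvPolynomial.aeval l P : ℝ) : ℂ) := by
  have h := MvPolynomial.comp_aeval (R := ℚ) ofRealQ (f := l)
  have := congrArg (fun φ => φ P) h
  simpa [Function.comp_def] using this.symm

theorem realHomLogSector_of_homLogSector (h : HomLogSector) : RealHomLogSector := by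
  intro n l halg hli d P hP hP0 hval
  refine h n _ (fun i => isAlgebraic_cexp_ofReal (halg i)) (linearIndependent_ofReal_comp hli) d P hP hP0 ?_
  rw [aeval_ofReal_comp, hval]; simp

theorem realLogHomogeneity_of_logHomogeneity (h : LogHomogeneity) : RealLogHomogeneity := by
  intro r l halg P hP d
  have h' := h r _ (fun j => isAlgebraic_cexp_ofReal (halg j)) P (by rw [aeval_ofReal_comp, hP]; simp) d
  rw [aeval_ofReal_comp] at h'
  exact_mod_cast h'

end Summit.Schanuel.Schanuel.Cruxes.RealLogSector.Calibration
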